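import Summits.CriticalPhenomena.PercolationContinuityZ3.Theorems.PercNearOneGluingNoHeavyLowerTailSahiOneStepAndLiteral
import HarnessLib

/-!
# One-step scheme: the SLOT-SHIFT IDENTITY for the `(2′)` functional `n`

Prover prim-ineq-prove-3 gen 26 (`--supports stmt-CriticalPhenomena-4575`; memo
`run/shared/lean/prim/prim-ineq-prove-3/FINDING-G26C-NORMAL-FORM.md` §9).  No definitions, no sorries.

For ARBITRARY events `X, Y`, a block `F` and a level `t`, with `S = {N_F = t}`, `σ = μ S`, `ℓ¹ = μ{N_F < t}`, `ℓ⁰ = μ{N_F < t+1}` and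
`U_Z = ℓ¹ μ(Z ∩ S) − σ μ(Z ∩ {N_F < t})`:
`σℓ⁰ · n_{N_F ≥ t}(X,Y) = σℓ¹ · n_{N_F ≥ t+1}(X,Y) + ℓ⁰ℓ¹ · [σ μ(X ∩ Y ∩ S) − μ(X ∩ S) μ(Y ∩ S)] + U_X · U_Y`
(`osN_threshold_slotShift`), i.e. `n_t = (ℓ¹/ℓ⁰) n_{t+1} + ℓ¹σ Cov_{N_F = t}(X,Y) + (ℓ¹²σ/ℓ⁰) u_X u_Y` with `u_Z = μ(Z ∣ N_F = t) − μ(Z ∣ N_F < t)`.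
So `n_{Th_t}` telescopes down from `n_{Th_{|F|+1}} = 0` with positive weights, gaining at each level the layer covariance and, for increasing
events, the nonnegative product `u_X u_Y` (`real_inter_ball_mul_layer_le'`).  This identity is the engine of the OR-literal step (`…OrLiteral`).
-/

noncomputable section

namespace Summit.CriticalPhenomena.PercolationContinuityZ3.Theorems

namespace SahiOneStep

open MeasureTheory Finset
open Literature.Probability.LatticeModels (prodBernoulli)
open Literature.Probability.Percolation.DecisionTree (ind)
open scoped Classical

variable {ι : Type*} [Fintype ι]

/-- **SLOT-SHIFT IDENTITY** (polynomial form), valid for arbitrary events `X, Y`. [this work] -/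
theorem osN_threshold_slotShift (p : ι → unitInterval) (F : Finset ι) (t : ℕ) (X Y : Set (Set ι)) :
    (prodBernoulli p).real {ω : Set ι | (F.filter (· ∈ ω)).card = t} *
        (prodBernoulli p).real {ω : Set ι | (F.filter (· ∈ ω)).card < t + 1} *
        osN p {ω : Set ι | t ≤ (F.filter (· ∈ ω)).card} (ind X) (ind Y) =
      (prodBernoulli p).real {ω : Set ι | (F.filter (· ∈ ω)).card = t} *
          (prodBernoulli p).real {ω : Set ι | (F.filter (· ∈ ω)).card < t} *
          osN p {ω : Set ι | t + 1 ≤ (F.filter (· ∈ ω)).card} (ind X) (ind Y)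
        + (prodBernoulli p).real {ω : Set ι | (F.filter (· ∈ ω)).card < t + 1} *
            (prodBernoulli p).real {ω : Set ι | (F.filter (· ∈ ω)).card < t} *
            ((prodBernoulli p).real {ω : Set ι | (F.filter (· ∈ ω)).card = t} *
                (prodBernoulli p).real (X ∩ Y ∩ {ω : Set ι | (F.filter (· ∈ ω)).card = t})
              - (prodBernoulli p).real (X ∩ {ω : Set ι | (F.filter (· ∈ ω)).card = t}) *
                (prodBernoulli p).real (Y ∩ {ω : Set ι | (F.filter (· ∈ ω)).card = t}))
        + ((prodBernoulli p).real {ω : Set ι | (F.filter (· ∈ ω)).card < t} *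
              (prodBernoulli p).real (X ∩ {ω : Set ι | (F.filter (· ∈ ω)).card = t})
            - (prodBernoulli p).real {ω : Set ι | (F.filter (· ∈ ω)).card = t} *
              (prodBernoulli p).real (X ∩ {ω : Set ι | (F.filter (· ∈ ω)).card < t})) *
          ((prodBernoulli p).real {ω : Set ι | (F.filter (· ∈ ω)).card < t} *
              (prodBernoulli p).real (Y ∩ {ω : Set ι | (F.filter (· ∈ ω)).card = t})
            - (prodBernoulli p).real {ω : Set ι | (F.filter (· ∈ ω)).card = t} *
              (prodBernoulli p).real (Y ∩ {ω : Set ι | (F.filter (· ∈ ω)).card < t})) := by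
  set μ := prodBernoulli p with hμ
  set H1 : Set (Set ι) := {ω : Set ι | t ≤ (F.filter (· ∈ ω)).card} with hH1
  set H0 : Set (Set ι) := {ω : Set ι | t + 1 ≤ (F.filter (· ∈ ω)).card} with hH0
  set L1 : Set (Set ι) := {ω : Set ι | (F.filter (· ∈ ω)).card < t} with hL1
  set L0 : Set (Set ι) := {ω : Set ι | (F.filter (· ∈ ω)).card < t + 1} with hL0
  set S : Set (Set ι) := {ω : Set ι | (F.filter (· ∈ ω)).card = t} with hS
  have hH01 : H0 ⊆ H1 := fun ω hω => by simp only [hH0, hH1, Set.mem_setOf_eq] at hω ⊢; omega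
  rw [osN_ind_ind, osN_ind_ind]
  -- set identities for the splits
  have cL0 : ∀ Z : Set (Set ι), Z \ H0 = Z ∩ L0 := fun Z => by
    ext ω; simp only [hH0, hL0, Set.mem_sdiff, Set.mem_inter_iff, Set.mem_setOf_eq, not_le]
  have cS : ∀ Z : Set (Set ι), (Z ∩ L0) \ L1 = Z ∩ S := fun Z => by
    ext ω; simp only [hL0, hL1, hS, Set.mem_sdiff, Set.mem_inter_iff, Set.mem_setOf_eq, not_lt]; constructor
    · rintro ⟨⟨hZ, h1⟩, h2⟩; exact ⟨hZ, by omega⟩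
    · rintro ⟨hZ, h⟩; exact ⟨⟨hZ, by omega⟩, by omega⟩
  have cSL : ∀ Z : Set (Set ι), (Z ∩ L0) ∩ L1 = Z ∩ L1 := fun Z => by
    ext ω; simp only [hL0, hL1, Set.mem_inter_iff, Set.mem_setOf_eq]; constructor
    · rintro ⟨⟨hZ, _⟩, h2⟩; exact ⟨hZ, h2⟩
    · rintro ⟨hZ, h⟩; exact ⟨⟨hZ, by omega⟩, h⟩
  have cH1S : ∀ Z : Set (Set ι), (H1 ∩ Z) \ H0 = Z ∩ S := fun Z => by
    ext ω; simp only [hH1, hH0, hS, Set.mem_sdiff, Set.mem_inter_iff, Set.mem_setOf_eq, not_le]; constructor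
    · rintro ⟨⟨h1, hZ⟩, h2⟩; exact ⟨hZ, by omega⟩
    · rintro ⟨hZ, h⟩; exact ⟨⟨by omega, hZ⟩, by omega⟩
  have cH1H0 : ∀ Z : Set (Set ι), (H1 ∩ Z) ∩ H0 = H0 ∩ Z := fun Z => by
    ext ω; simp only [Set.mem_inter_iff]; constructor
    · rintro ⟨⟨_, hZ⟩, h0⟩; exact ⟨h0, hZ⟩
    · rintro ⟨h0, hZ⟩; exact ⟨⟨hH01 h0, hZ⟩, h0⟩
  have split0 : ∀ Z : Set (Set ι), μ.real Z = μ.real (H0 ∩ Z) + μ.real (Z ∩ L0) := fun Z => by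
    have h := measureReal_inter_add_sdiff (μ := μ) (s := Z) (t := H0) MeasurableSet.of_discrete
    rw [cL0, Set.inter_comm Z H0] at h; linarith
  have splitS : ∀ Z : Set (Set ι), μ.real (Z ∩ L0) = μ.real (Z ∩ L1) + μ.real (Z ∩ S) := fun Z => by
    have h := measureReal_inter_add_sdiff (μ := μ) (s := Z ∩ L0) (t := L1) MeasurableSet.of_discrete
    rw [cSL, cS] at h; linarith
  have splitH1 : ∀ Z : Set (Set ι), μ.real (H1 ∩ Z) = μ.real (Z ∩ S) + μ.real (H0 ∩ Z) := fun Z => by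
    have h := measureReal_inter_add_sdiff (μ := μ) (s := H1 ∩ Z) (t := H0) MeasurableSet.of_discrete
    rw [cH1H0, cH1S] at h; linarith
  -- pieces
  set l1 : ℝ := μ.real L1 with hl1
  set σ : ℝ := μ.real S with hσ
  set xL : ℝ := μ.real (X ∩ L1)
  set xS : ℝ := μ.real (X ∩ S)
  set xH : ℝ := μ.real (H0 ∩ X)
  set yL : ℝ := μ.real (Y ∩ L1)
  set yS : ℝ := μ.real (Y ∩ S)
  set yH : ℝ := μ.real (H0 ∩ Y)
  set zL : ℝ := μ.real (X ∩ Y ∩ L1)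
  set zS : ℝ := μ.real (X ∩ Y ∩ S)
  set zH : ℝ := μ.real (H0 ∩ (X ∩ Y))
  have eX : μ.real X = xH + (xL + xS) := by rw [split0 X, splitS X]
  have eY : μ.real Y = yH + (yL + yS) := by rw [split0 Y, splitS Y]
  have eH1X : μ.real (H1 ∩ X) = xS + xH := splitH1 X
  have eH1Y : μ.real (H1 ∩ Y) = yS + yH := splitH1 Y
  have eH1XY : μ.real (H1 ∩ X ∩ Y) = zS + zH := by rw [Set.inter_assoc]; exact splitH1 (X ∩ Y)
  have eH0XY : μ.real (H0 ∩ X ∩ Y) = zH := by rw [Set.inter_assoc]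
  have eL0 : μ.real L0 = l1 + σ := by have h := splitS Set.univ; simp only [Set.univ_inter] at h; exact h
  have eH1 : μ.real H1 = 1 - l1 := by
    have h := splitH1 Set.univ; have h' := split0 Set.univ
    simp only [Set.inter_univ, Set.univ_inter, probReal_univ] at h h'; linarith
  have eH0 : μ.real H0 = 1 - l1 - σ := by
    have h' := split0 Set.univ; simp only [Set.inter_univ, Set.univ_inter, probReal_univ] at h'; linarith
  have eH0X : μ.real (H0 ∩ X) = xH := rfl
  have eH0Y : μ.real (H0 ∩ Y) = yH := rfl
  rw [eH1, eH1XY, eH1X, eH1Y, eX, eY, eH0, eH0XY, eL0]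
  ring

end SahiOneStep

end Summit.CriticalPhenomena.PercolationContinuityZ3.Theorems
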